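import Literature.NumberTheory.Automorphic.BrandtXi
import HarnessLib

/-!
# The Brandt weights are class functions: `w([α I]) = w([I])`

Topic `NumberTheory/Automorphic`; theorems only (no definitions, no named facts), completing a
claim made in the docstrings of `Literature/NumberTheory/Automorphic/BrandtXi.lean`
(`Brandt.weight`: "Left orders of `I` and `α I` are conjugate, so this is a class function";
`Brandt.ClassSet.rep`: "every construction below is invariant under `I ↦ α I`"), where the weight
`w_c = |O_L(I_c)ˣ| / 2` (Voight 41.1.3; Gross 1987 §1; Pizer 1980 §2) is *defined* on the
representative `I_c = c.rep` chosen by `Quotient.out`. We prove: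

* `Brandt.mem_leftOrder_smul_iff`: `O_L(α I) = α O_L(I) α⁻¹`, i.e.
  `x ∈ O_L(α • I) ↔ α⁻¹ x α ∈ O_L(I)` for `α ∈ Dˣ` (Voight 10.2, Exercise; immediate);
* `Brandt.rightOrder_smul`: `O_R(α I) = O_R(I)`;
* `Brandt.nonempty_unitsEquiv_of_smul`: conjugation `x ↦ α⁻¹ x α` is a bijection between the unit sets
  `{x ∈ O_L(α I) | x invertible in O_L(α I)}` and `{x ∈ O_L(I) | x invertible in O_L(I)}`, whence
  `Brandt.unitIndex_leftOrder_smul`: `w(O_L(α I)) = w(O_L(I))`;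
* `Brandt.weight_mk`: for every invertible right `O`-ideal `I`, the weight of its class is
  `|O_L(I)ˣ| / 2` computed on `I` itself — the weights of `BrandtXi.lean` do not depend on the
  representatives.

## References

* J. Voight, *Quaternion Algebras*, GTM 288 (2021), Def. 10.2.8, 17.3, 41.1.3 [Voight2021].
* A. Pizer, J. Algebra 64 (1980), §2 (the `e_j = |O_jˣ|`) [Pizer1980].
-/

noncomputable section

open scoped Pointwise

universe u

namespace Literature.NumberTheory.Automorphic

namespace Brandt

variable {D : Type u} [Ring D]

/-- Membership in the translate `α • I`: `m ∈ α I ↔ α⁻¹ m ∈ I`.  DUPLICATE (dedup-00657) of the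
tree's `mem_units_smul_submodule_iff` (`JordanZassenhaus.lean`, unit implicit); kept only as a
deprecated alias — the rewrites below use the survivor. [folklore] -/
@[deprecated (since := "2026-08-15")]
alias mem_smul_iff_inv_mul_mem := mem_units_smul_submodule_iff

/-- **Left orders are conjugated by left translation**: `O_L(α I) = α O_L(I) α⁻¹`, i.e.
`x ∈ O_L(α • I) ↔ α⁻¹ x α ∈ O_L(I)` (Voight 2021, §10.2). [cite: Voight2021, Def. 10.2.8 (left order; conjugation)] -/
theorem mem_leftOrder_smul_iff (α : Dˣ) {I : Submodule ℤ D} {x : D} :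
    x ∈ leftOrder (α • I) ↔ ((α⁻¹ : Dˣ) : D) * x * α ∈ leftOrder I := by
  simp only [mem_leftOrder_iff]
  constructor
  · intro h m hm
    have hαm : (α : D) * m ∈ α • I := by
      rw [mem_units_smul_submodule_iff, Units.smul_def, smul_eq_mul, ← mul_assoc, Units.inv_mul,
        one_mul]
      exact hm
    have := h _ hαm
    rw [mem_units_smul_submodule_iff, Units.smul_def, smul_eq_mul] at this
    simpa [mul_assoc] using this
  · intro h m hm
    rw [mem_units_smul_submodule_iff, Units.smul_def, smul_eq_mul] at hm
    have := h _ hm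
    rw [mem_units_smul_submodule_iff, Units.smul_def, smul_eq_mul]
    -- `α⁻¹ (x m) = (α⁻¹ x α) (α⁻¹ m)`
    have e : ((α⁻¹ : Dˣ) : D) * (x * m) = ((α⁻¹ : Dˣ) : D) * x * α * (((α⁻¹ : Dˣ) : D) * m) := by
      simp [mul_assoc]
    rw [e]
    exact this

/-- **Right orders are invariant under left translation**: `O_R(α I) = O_R(I)`. [folklore] -/
theorem rightOrder_smul (α : Dˣ) (I : Submodule ℤ D) : rightOrder (α • I) = rightOrder I := by
  ext x
  simp only [mem_rightOrder_iff]
  constructor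
  · intro h m hm
    have hαm : (α : D) * m ∈ α • I := by
      rw [mem_units_smul_submodule_iff, Units.smul_def, smul_eq_mul, ← mul_assoc, Units.inv_mul,
        one_mul]
      exact hm
    have := h _ hαm
    rw [mem_units_smul_submodule_iff, Units.smul_def, smul_eq_mul, mul_assoc, ← mul_assoc,
      Units.inv_mul, one_mul] at this
    exact this
  · intro h m hm
    rw [mem_units_smul_submodule_iff, Units.smul_def, smul_eq_mul] at hm
    have := h _ hm
    rw [mem_units_smul_submodule_iff, Units.smul_def, smul_eq_mul, ← mul_assoc]
    exact this

/-- Conjugation by `α⁻¹` maps `O_L(α I)` into `O_L(I)`. [folklore] -/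
theorem conj_mem_leftOrder_of_mem {α : Dˣ} {I : Submodule ℤ D} {x : D}
    (hx : x ∈ leftOrder (α • I)) : ((α⁻¹ : Dˣ) : D) * x * α ∈ leftOrder I :=
  (mem_leftOrder_smul_iff α).mp hx

/-- Conjugation by `α` maps `O_L(I)` into `O_L(α I)`. [folklore] -/
theorem conj_mem_leftOrder_smul_of_mem {α : Dˣ} {I : Submodule ℤ D} {y : D}
    (hy : y ∈ leftOrder I) : (α : D) * y * ((α⁻¹ : Dˣ) : D) ∈ leftOrder (α • I) := by
  rw [mem_leftOrder_smul_iff α]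
  have : ((α⁻¹ : Dˣ) : D) * ((α : D) * y * ((α⁻¹ : Dˣ) : D)) * α = y := by
    simp [mul_assoc]
  rw [this]
  exact hy

/-- **The unit sets of `O_L(α I)` and `O_L(I)` are in bijection** by conjugation
`x ↦ α⁻¹ x α` (with inverse `y ↦ α y α⁻¹`): the sets `{x ∈ O | ∃ y ∈ O, x y = y x = 1}`
counted by `Brandt.unitIndex` (stated as `Nonempty (_ ≃ _)` to keep this file free of definitions). [folklore] -/
theorem nonempty_unitsEquiv_of_smul (α : Dˣ) (I : Submodule ℤ D) :
    Nonempty ({x : D // x ∈ leftOrder (α • I) ∧ ∃ y ∈ leftOrder (α • I), x * y = 1 ∧ y * x = 1} ≃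
      {x : D // x ∈ leftOrder I ∧ ∃ y ∈ leftOrder I, x * y = 1 ∧ y * x = 1}) := ⟨{
  toFun x := ⟨((α⁻¹ : Dˣ) : D) * x.1 * α, conj_mem_leftOrder_of_mem x.2.1, by
    obtain ⟨y, hy, hxy, hyx⟩ := x.2.2
    refine ⟨((α⁻¹ : Dˣ) : D) * y * α, conj_mem_leftOrder_of_mem hy, ?_, ?_⟩
    · calc ((α⁻¹ : Dˣ) : D) * x.1 * α * (((α⁻¹ : Dˣ) : D) * y * α)
          = ((α⁻¹ : Dˣ) : D) * (x.1 * y) * α := by simp [mul_assoc]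
        _ = 1 := by rw [hxy]; simp
    · calc ((α⁻¹ : Dˣ) : D) * y * α * (((α⁻¹ : Dˣ) : D) * x.1 * α)
          = ((α⁻¹ : Dˣ) : D) * (y * x.1) * α := by simp [mul_assoc]
        _ = 1 := by rw [hyx]; simp⟩
  invFun y := ⟨(α : D) * y.1 * ((α⁻¹ : Dˣ) : D), conj_mem_leftOrder_smul_of_mem y.2.1, by
    obtain ⟨z, hz, hyz, hzy⟩ := y.2.2
    refine ⟨(α : D) * z * ((α⁻¹ : Dˣ) : D), conj_mem_leftOrder_smul_of_mem hz, ?_, ?_⟩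
    · calc (α : D) * y.1 * ((α⁻¹ : Dˣ) : D) * ((α : D) * z * ((α⁻¹ : Dˣ) : D))
          = (α : D) * (y.1 * z) * ((α⁻¹ : Dˣ) : D) := by simp [mul_assoc]
        _ = 1 := by rw [hyz]; simp
    · calc (α : D) * z * ((α⁻¹ : Dˣ) : D) * ((α : D) * y.1 * ((α⁻¹ : Dˣ) : D))
          = (α : D) * (z * y.1) * ((α⁻¹ : Dˣ) : D) := by simp [mul_assoc]
        _ = 1 := by rw [hzy]; simp⟩
  left_inv x := by
    apply Subtype.ext
    simp [mul_assoc]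
  right_inv y := by
    apply Subtype.ext
    simp [mul_assoc] }⟩

/-- **The unit index is invariant under conjugation of the left order**:
`w(O_L(α I)) = w(O_L(I))` (`Nat.card` along the bijection of `nonempty_unitsEquiv_of_smul`). [folklore] -/
theorem unitIndex_leftOrder_smul (α : Dˣ) (I : Submodule ℤ D) :
    unitIndex (leftOrder (α • I)) = unitIndex (leftOrder I) := by
  obtain ⟨e⟩ := nonempty_unitsEquiv_of_smul α I
  simp only [unitIndex, Nat.card_congr e]

/-- **The Brandt weight is a class function**: for an invertible right `O`-ideal `I` (an element
of `rightIdeals O`), the weight of its class `[I] ∈ Cls O` — defined in `BrandtXi.lean` on the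
representative `Quotient.out [I]` — equals `|O_L(I)ˣ| / 2` computed on `I` itself
(Voight 41.1.3: `w_i` depends only on the class). [cite: Voight2021, 41.1.3] -/
theorem weight_mk (O : Submodule ℤ D) (I : rightIdeals O) :
    weight O (Quotient.mk (rightClassSetoid O) I) = unitIndex (leftOrder (I : Submodule ℤ D)) := by
  set c : ClassSet O := Quotient.mk (rightClassSetoid O) I with hc
  -- the chosen representative of `c` is `α • I` for some unit `α`
  have hrel : (rightClassSetoid O) I (Quotient.out c) :=
    Quotient.exact ((Quotient.out_eq c).trans hc).symm
  obtain ⟨α, hα⟩ := hrel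
  have hrep : c.rep = α • (I : Submodule ℤ D) := hα
  rw [weight, hrep, unitIndex_leftOrder_smul]

/-- Two right ideals in the same class have the same weight `|O_L(·)ˣ| / 2`. [folklore] -/
theorem unitIndex_leftOrder_eq_of_mk_eq (O : Submodule ℤ D) {I J : rightIdeals O}
    (h : (Quotient.mk (rightClassSetoid O) I : ClassSet O) = Quotient.mk (rightClassSetoid O) J) :
    unitIndex (leftOrder (I : Submodule ℤ D)) = unitIndex (leftOrder (J : Submodule ℤ D)) := by
  rw [← weight_mk O I, ← weight_mk O J, h]

end Brandt

end Literature.NumberTheory.Automorphic
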